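import Summits.BirchSwinnertonDyer.BirchSwinnertonDyer.Theorems.ByReductionTypeAtTwoSupersingularConjATwoGoodSSRowFieldCertificatesA
import Summits.BirchSwinnertonDyer.BirchSwinnertonDyer.Theorems.ByReductionTypeAtTwoSupersingularConjATwoGoodSSRowFieldCertificatesB
import Literature.NumberTheory.NumberFields.CubicFieldUnitSignatureCertificate
import HarnessLib

/-!
# Route `ByReductionTypeAtTwo` (rung K4), crux `SupersingularRankZeroAtTwo` (item stmt-BirchSwinnertonDyer-19097), registry v2.12 stub 3
# `stub_fineMu : FineMuZeroOnHabitatAtTwo`: KERNEL UNIT-SIGNATURE CERTIFICATES for the three TOTALLY REAL `2`-division cubic fields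
# of the h12 tranche — `d = 148` (`X³ − X² − 3X + 1`, row `37b1`), `d = 564` (`X³ − X² − 5X + 3`, row `141e1`), `d = 756` (`X³ − 6X − 2`,
# rows `189c1`, `189d1`): their units take ALL EIGHT signatures (a `--supports 19097` toolkit file; seat `bsd-2adic-t42` GEN 44, task T-85
# «THE NARROW DOOR RE-KEY» of director-bsd (825)(ii) / `-imc` g33 D-imc-85; consumer `…GoodSSGenusRowsTotallyReal`)

HONEST LABEL (cell `bsd-2adic`, D-0036/D-0054): UNCONDITIONAL kernel arithmetic about three cubic number fields; THEOREMS ONLY (no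
definition, no named fact, no `sorry`); closes nothing; nothing booked; BSD is proved for no curve. PURPOSE: the `hsig` input
(`Function.Surjective signVec`) of the signature genus door `…GoodSSGenusDoor.conjA_two_goodSSModel_of_generator_of_signVec_surjective`
(Chevalley WITH SIGNATURES on `ℚ(θ, √−1)/ℚ(θ)`, p724470), which re-keys the four `Δ_E > 0` rows with NO Lim fact.

THE CERTIFICATES (template: k4-w1 GEN 8 `…AdditivePotGoodGenusStampsE` for `d = 8372`). Per field: the cubic is irreducible (GEN 43
`irreducible_cubic_twoDivField_d…`), so `[ℚ(θ):ℚ] = 3`; three real roots isolated in rational intervals of width `10⁻⁵` (exact sign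
changes + IVT, `exists_cubic_root_Ioo_of_…`) give three distinct real embeddings `ρ₀, ρ₁, ρ₂` (`exists_ringHom_adjoin_apply_gen_eq`); two
explicit units of `ℤ[θ]` (`-imc`'s D-imc-85 witnesses, re-verified exactly with inverses and Bézout multipliers, cell sources
`t42/gen44/unitsig.py`, `unitsig2.py`) with sign vectors `(0,0,1)` and `(0,1,0)` at `(ρ₀, ρ₁, ρ₂)` by the endpoint test
(`quadratic_pos/neg_of_endpoints`, margins `m` displayed); with `−1 ↦ (1,1,1)` the eight predicted sign vectors are distinct (`decide`), so
`signVec_surjective_of_two_units` applies. `d = 148`: `u₁ = 1 − 3θ + θ²` (`u₁⁻¹ = 6 + θ − 2θ²`), `u₂ = −8 + 2θ + 5θ²` (`14 − 52θ + 21θ²`);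
`d = 564`: `u₁ = 2 − 4θ + θ²` (`26 + 2θ − 5θ²`), `u₂ = −10 − θ + 2θ²` (`−1 + θ + θ²`); `d = 756`: `u₁ = −1 − 5θ − 2θ²` (`1 − 3θ + θ²`),
`u₂ = −5 + θ²` (`−1 − 2θ + θ²`).

References: [FrohlichTaylor1990] Ch. V §1 (1.10)–(1.13); [Cohen1993] §4.1.3, App. B; tree `CubicFieldUnitSignatureCertificate` (k4-w1 GEN 8),
GEN 43 ★ p822757/p822758 (irreducibility, `h` odd).
-/
set_option autoImplicit false
-- sibling precedent (`…GoodSSRowFieldCertificatesA.lean`): the directory name repeats the summit name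
set_option linter.dupNamespace false

noncomputable section

open scoped Classical IntermediateField NumberField

namespace Summit.BirchSwinnertonDyer.BirchSwinnertonDyer.Theorems.AddKatoTwo

open WeierstrassCurve Field Polynomial IsDedekindDomain NumberField Literature.NumberTheory.EllipticCurves
  Literature.NumberTheory.GaloisRepresentations Literature.NumberTheory.IwasawaTheory Literature.NumberTheory.NumberFields
  Literature.Geometry.Kaehler.ComplexTorus
  Summit.BirchSwinnertonDyer.BirchSwinnertonDyer.Theorems.AlignedTransportAtTwoTorsionPointField
  Summit.BirchSwinnertonDyer.BirchSwinnertonDyer.Theses.ByReductionTypeAtTwo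

/-! ## §1 Unit-signature certificates of the three totally real cubic fields -/

section Certificates

/-- A function on `Fin 3` with pairwise distinct values is injective. [folklore] -/
private theorem injective_fin_three' {α : Type*} {f : Fin 3 → α} (h01 : f 0 ≠ f 1) (h02 : f 0 ≠ f 2) (h12 : f 1 ≠ f 2) :
    Function.Injective f := by
  intro a c hac
  fin_cases a <;> fin_cases c
  all_goals first
    | rfl
    | exact absurd hac h01
    | exact absurd hac.symm h01
    | exact absurd hac h02
    | exact absurd hac.symm h02
    | exact absurd hac h12
    | exact absurd hac.symm h12

/-- The value in `K` of the unit `a₀ + a₁ b + a₂ b²` built by `Units.mkOfMulEqOne`, read at `t = b`. [folklore] -/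
private theorem coe_mkOfMulEqOne_quad {K : Type} [Field K] [NumberField K] {b : 𝓞 K} {t : K}
    (hbt : algebraMap (𝓞 K) K b = t) (a₀ a₁ a₂ : ℤ) (y : 𝓞 K)
    (h : (((a₀ : ℤ) : 𝓞 K) + ((a₁ : ℤ) : 𝓞 K) * b + ((a₂ : ℤ) : 𝓞 K) * b ^ 2) * y = 1) :
    (((Units.mkOfMulEqOne _ y h : (𝓞 K)ˣ) : 𝓞 K) : K) = (a₀ : K) + (a₁ : K) * t + (a₂ : K) * t ^ 2 := by
  rw [Units.val_mkOfMulEqOne, NumberField.RingOfIntegers.coe_eq_algebraMap, map_add, map_add, map_mul, map_mul, map_pow, hbt,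
    map_intCast, map_intCast, map_intCast]


/-! ### The totally real cubic field `d = 148`: `X³ − X² − 3X + 1` (rows `37b1`) -/

/-- **The units of the totally real cubic field `ℚ(θ)`, `θ` a root of `X³ − X² − 3X + 1` (`d = 148`), take ALL EIGHT signatures** — KERNEL:
three real roots isolated in rational intervals of width `10⁻⁵`; units `u₁ = 1 − 3θ + 1θ²`, `u₂ = -8 + 2θ + 5θ²` (`-imc` D-imc-85
witnesses, inverses `6 + 1θ − 2θ²`, `14 − 52θ + 21θ²`) with sign bits `(0, 0, 1)`, `(0, 1, 0)` at the three embeddings;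
`signVec_surjective_of_two_units`. [cite: FrohlichTaylor1990, Ch. V §1 (1.12), p. 164] [cite: Cohen1993, §4.1.3 and App. B (d = 148)] -/
theorem signVec_surjective_cubicField_d148p {θ : AlgebraicClosure ℚ}
    (hθ : aeval θ (Cubic.toPoly ⟨1, ((-1 : ℤ) : ℚ), ((-3 : ℤ) : ℚ), ((1 : ℤ) : ℚ)⟩) = 0)
    [NumberField (IntermediateField.adjoin ℚ {θ})] :
    Function.Surjective (signVec (K := ↥(IntermediateField.adjoin ℚ {θ}))) := by
  set K := IntermediateField.adjoin ℚ {θ} with hKdef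
  have h3 : Module.finrank ℚ K = 3 := finrank_adjoin_eq_three_of_irreducible irreducible_cubic_twoDivField_d148p hθ
  -- three real roots
  obtain ⟨x₀, hl₀, hu₀, hx₀⟩ := exists_cubic_root_Ioo_of_neg_of_pos (p := (-1 : ℝ)) (q := -3) (r := 1)
    (l := -3703 / 2500) (u := -148119 / 100000) (by norm_num) (by norm_num) (by norm_num)
  obtain ⟨x₁, hl₁, hu₁, hx₁⟩ := exists_cubic_root_Ioo_of_pos_of_neg (p := (-1 : ℝ)) (q := -3) (r := 1)
    (l := 3111 / 10000) (u := 31111 / 100000) (by norm_num) (by norm_num) (by norm_num)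
  obtain ⟨x₂, hl₂, hu₂, hx₂⟩ := exists_cubic_root_Ioo_of_neg_of_pos (p := (-1 : ℝ)) (q := -3) (r := 1)
    (l := 13563 / 6250) (u := 217009 / 100000) (by norm_num) (by norm_num) (by norm_num)
  have haev : ∀ x : ℝ, x ^ 3 + (-1) * x ^ 2 + (-3) * x + (1) = 0 →
      aeval x (Cubic.toPoly ⟨1, ((-1 : ℤ) : ℚ), ((-3 : ℤ) : ℚ), ((1 : ℤ) : ℚ)⟩) = 0 := fun x hx => by
    simp only [Cubic.toPoly, map_one, one_mul, aeval_add, aeval_mul, aeval_C, aeval_X_pow, aeval_X, eq_ratCast,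
      Rat.cast_intCast]
    push_cast
    linear_combination hx
  obtain ⟨ρ₀, hρ₀⟩ := exists_ringHom_adjoin_apply_gen_eq (P := ⟨1, ((-1 : ℤ) : ℚ), ((-3 : ℤ) : ℚ), ((1 : ℤ) : ℚ)⟩) rfl
    irreducible_cubic_twoDivField_d148p hθ (haev x₀ hx₀)
  obtain ⟨ρ₁, hρ₁⟩ := exists_ringHom_adjoin_apply_gen_eq (P := ⟨1, ((-1 : ℤ) : ℚ), ((-3 : ℤ) : ℚ), ((1 : ℤ) : ℚ)⟩) rfl
    irreducible_cubic_twoDivField_d148p hθ (haev x₁ hx₁)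
  obtain ⟨ρ₂, hρ₂⟩ := exists_ringHom_adjoin_apply_gen_eq (P := ⟨1, ((-1 : ℤ) : ℚ), ((-3 : ℤ) : ℚ), ((1 : ℤ) : ℚ)⟩) rfl
    irreducible_cubic_twoDivField_d148p hθ (haev x₂ hx₂)
  have hx01 : x₀ ≠ x₁ := by intro h; rw [h] at hu₀; linarith
  have hx02 : x₀ ≠ x₂ := by intro h; rw [h] at hu₀; linarith
  have hx12 : x₁ ≠ x₂ := by intro h; rw [h] at hu₁; linarith
  set ρ : Fin 3 → (K →+* ℝ) := ![ρ₀, ρ₁, ρ₂] with hρdef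
  have hne : ∀ {φ ψ : K →+* ℝ} {a c : ℝ}, φ (IntermediateField.AdjoinSimple.gen ℚ θ) = a →
      ψ (IntermediateField.AdjoinSimple.gen ℚ θ) = c → a ≠ c → φ ≠ ψ := by
    intro φ ψ a c ha hc hac h
    rw [h] at ha
    exact hac (ha.symm.trans hc)
  have hρ : Function.Injective ρ :=
    injective_fin_three' (hne hρ₀ hρ₁ hx01) (hne hρ₀ hρ₂ hx02) (hne hρ₁ hρ₂ hx12)
  -- the two units
  obtain ⟨b, hbθ, hb⟩ := exists_ringOfIntegers_cubic_root (p := -1) (q := -3) (r := 1) hθ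
  have hbgen : algebraMap (𝓞 K) K b = IntermediateField.AdjoinSimple.gen ℚ θ := Subtype.ext hbθ
  have hb' : b ^ 3 + (-1 : 𝓞 K) * b ^ 2 + (-3 : 𝓞 K) * b + (1 : 𝓞 K) = 0 := by
    have h := hb
    push_cast at h
    linear_combination h
  obtain ⟨e₁, he₁⟩ : ∃ e : (𝓞 K)ˣ, ((e : 𝓞 K) : K) = ((1 : ℤ) : K) + ((-3 : ℤ) : K) * IntermediateField.AdjoinSimple.gen ℚ θ +
      ((1 : ℤ) : K) * IntermediateField.AdjoinSimple.gen ℚ θ ^ 2 :=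
    ⟨_, coe_mkOfMulEqOne_quad hbgen (1) (-3) (1)
      (((6 : ℤ) : 𝓞 K) + ((1 : ℤ) : 𝓞 K) * b + ((-2 : ℤ) : 𝓞 K) * b ^ 2)
      (by push_cast; linear_combination ((5 : 𝓞 K) + (-2 : 𝓞 K) * b) * hb')⟩
  obtain ⟨e₂, he₂⟩ : ∃ e : (𝓞 K)ˣ, ((e : 𝓞 K) : K) = ((-8 : ℤ) : K) + ((2 : ℤ) : K) * IntermediateField.AdjoinSimple.gen ℚ θ +
      ((5 : ℤ) : K) * IntermediateField.AdjoinSimple.gen ℚ θ ^ 2 :=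
    ⟨_, coe_mkOfMulEqOne_quad hbgen (-8) (2) (5)
      (((14 : ℤ) : 𝓞 K) + ((-52 : ℤ) : 𝓞 K) * b + ((21 : ℤ) : 𝓞 K) * b ^ 2)
      (by push_cast; linear_combination ((-113 : 𝓞 K) + (105 : 𝓞 K) * b) * hb')⟩
  -- sign bits at the three embeddings (endpoint tests)
  have hs₁ : ∀ j, signVec e₁ (ρ j) = ![0, 0, 1] j := by
    intro j; fin_cases j
    · show signVec e₁ ρ₀ = 0
      refine signVec_apply_eq_zero_of_pos ρ₀ e₁ hρ₀ he₁ ?_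
      have := quadratic_pos_of_endpoints (a₀ := (1 : ℝ)) (a₁ := -3) (a₂ := 1) (m := 7) hl₀.le hu₀.le (by norm_num)
        (by norm_num) (by norm_num) (by norm_num)
      push_cast; linarith
    · show signVec e₁ ρ₁ = 0
      refine signVec_apply_eq_zero_of_pos ρ₁ e₁ hρ₁ he₁ ?_
      have := quadratic_pos_of_endpoints (a₀ := (1 : ℝ)) (a₁ := -3) (a₂ := 1) (m := 1 / 10) hl₁.le hu₁.le (by norm_num)
        (by norm_num) (by norm_num) (by norm_num)
      push_cast; linarith
    · show signVec e₁ ρ₂ = 1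
      refine signVec_apply_eq_one_of_neg ρ₂ e₁ hρ₂ he₁ ?_
      have := quadratic_neg_of_endpoints (a₀ := (1 : ℝ)) (a₁ := -3) (a₂ := 1) (m := 1 / 2) hl₂.le hu₂.le (by norm_num)
        (by norm_num) (by norm_num) (by norm_num)
      push_cast; linarith
  have hs₂ : ∀ j, signVec e₂ (ρ j) = ![0, 1, 0] j := by
    intro j; fin_cases j
    · show signVec e₂ ρ₀ = 0
      refine signVec_apply_eq_zero_of_pos ρ₀ e₂ hρ₀ he₂ ?_
      have := quadratic_pos_of_endpoints (a₀ := (-8 : ℝ)) (a₁ := 2) (a₂ := 5) (m := 7 / 1000) hl₀.le hu₀.le (by norm_num)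
        (by norm_num) (by norm_num) (by norm_num)
      push_cast; linarith
    · show signVec e₂ ρ₁ = 1
      refine signVec_apply_eq_one_of_neg ρ₁ e₂ hρ₁ he₂ ?_
      have := quadratic_neg_of_endpoints (a₀ := (-8 : ℝ)) (a₁ := 2) (a₂ := 5) (m := 6) hl₁.le hu₁.le (by norm_num)
        (by norm_num) (by norm_num) (by norm_num)
      push_cast; linarith
    · show signVec e₂ ρ₂ = 0
      refine signVec_apply_eq_zero_of_pos ρ₂ e₂ hρ₂ he₂ ?_
      have := quadratic_pos_of_endpoints (a₀ := (-8 : ℝ)) (a₁ := 2) (a₂ := 5) (m := 19) hl₂.le hu₂.le (by norm_num)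
        (by norm_num) (by norm_num) (by norm_num)
      push_cast; linarith
  exact signVec_surjective_of_two_units h3 ρ hρ e₁ e₂ ![0, 0, 1] ![0, 1, 0] hs₁ hs₂ (by decide)


/-! ### The totally real cubic field `d = 564`: `X³ − X² − 5X + 3` (rows `141e1`) -/

/-- **The units of the totally real cubic field `ℚ(θ)`, `θ` a root of `X³ − X² − 5X + 3` (`d = 564`), take ALL EIGHT signatures** — KERNEL:
three real roots isolated in rational intervals of width `10⁻⁵`; units `u₁ = 2 − 4θ + 1θ²`, `u₂ = -10 − 1θ + 2θ²` (`-imc` D-imc-85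
witnesses, inverses `26 + 2θ − 5θ²`, `-1 + 1θ + 1θ²`) with sign bits `(0, 0, 1)`, `(0, 1, 0)` at the three embeddings;
`signVec_surjective_of_two_units`. [cite: FrohlichTaylor1990, Ch. V §1 (1.12), p. 164] [cite: Cohen1993, §4.1.3 and App. B (d = 564)] -/
theorem signVec_surjective_cubicField_d564p {θ : AlgebraicClosure ℚ}
    (hθ : aeval θ (Cubic.toPoly ⟨1, ((-1 : ℤ) : ℚ), ((-5 : ℤ) : ℚ), ((3 : ℤ) : ℚ)⟩) = 0)
    [NumberField (IntermediateField.adjoin ℚ {θ})] :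
    Function.Surjective (signVec (K := ↥(IntermediateField.adjoin ℚ {θ}))) := by
  set K := IntermediateField.adjoin ℚ {θ} with hKdef
  have h3 : Module.finrank ℚ K = 3 := finrank_adjoin_eq_three_of_irreducible irreducible_cubic_twoDivField_d564p hθ
  -- three real roots
  obtain ⟨x₀, hl₀, hu₀, hx₀⟩ := exists_cubic_root_Ioo_of_neg_of_pos (p := (-1 : ℝ)) (q := -5) (r := 3)
    (l := -104307 / 50000) (u := -208613 / 100000) (by norm_num) (by norm_num) (by norm_num)
  obtain ⟨x₁, hl₁, hu₁, hx₁⟩ := exists_cubic_root_Ioo_of_pos_of_neg (p := (-1 : ℝ)) (q := -5) (r := 3)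
    (l := 57199 / 100000) (u := 143 / 250) (by norm_num) (by norm_num) (by norm_num)
  obtain ⟨x₂, hl₂, hu₂, hx₂⟩ := exists_cubic_root_Ioo_of_neg_of_pos (p := (-1 : ℝ)) (q := -5) (r := 3)
    (l := 251413 / 100000) (u := 125707 / 50000) (by norm_num) (by norm_num) (by norm_num)
  have haev : ∀ x : ℝ, x ^ 3 + (-1) * x ^ 2 + (-5) * x + (3) = 0 →
      aeval x (Cubic.toPoly ⟨1, ((-1 : ℤ) : ℚ), ((-5 : ℤ) : ℚ), ((3 : ℤ) : ℚ)⟩) = 0 := fun x hx => by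
    simp only [Cubic.toPoly, map_one, one_mul, aeval_add, aeval_mul, aeval_C, aeval_X_pow, aeval_X, eq_ratCast,
      Rat.cast_intCast]
    push_cast
    linear_combination hx
  obtain ⟨ρ₀, hρ₀⟩ := exists_ringHom_adjoin_apply_gen_eq (P := ⟨1, ((-1 : ℤ) : ℚ), ((-5 : ℤ) : ℚ), ((3 : ℤ) : ℚ)⟩) rfl
    irreducible_cubic_twoDivField_d564p hθ (haev x₀ hx₀)
  obtain ⟨ρ₁, hρ₁⟩ := exists_ringHom_adjoin_apply_gen_eq (P := ⟨1, ((-1 : ℤ) : ℚ), ((-5 : ℤ) : ℚ), ((3 : ℤ) : ℚ)⟩) rfl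
    irreducible_cubic_twoDivField_d564p hθ (haev x₁ hx₁)
  obtain ⟨ρ₂, hρ₂⟩ := exists_ringHom_adjoin_apply_gen_eq (P := ⟨1, ((-1 : ℤ) : ℚ), ((-5 : ℤ) : ℚ), ((3 : ℤ) : ℚ)⟩) rfl
    irreducible_cubic_twoDivField_d564p hθ (haev x₂ hx₂)
  have hx01 : x₀ ≠ x₁ := by intro h; rw [h] at hu₀; linarith
  have hx02 : x₀ ≠ x₂ := by intro h; rw [h] at hu₀; linarith
  have hx12 : x₁ ≠ x₂ := by intro h; rw [h] at hu₁; linarith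
  set ρ : Fin 3 → (K →+* ℝ) := ![ρ₀, ρ₁, ρ₂] with hρdef
  have hne : ∀ {φ ψ : K →+* ℝ} {a c : ℝ}, φ (IntermediateField.AdjoinSimple.gen ℚ θ) = a →
      ψ (IntermediateField.AdjoinSimple.gen ℚ θ) = c → a ≠ c → φ ≠ ψ := by
    intro φ ψ a c ha hc hac h
    rw [h] at ha
    exact hac (ha.symm.trans hc)
  have hρ : Function.Injective ρ :=
    injective_fin_three' (hne hρ₀ hρ₁ hx01) (hne hρ₀ hρ₂ hx02) (hne hρ₁ hρ₂ hx12)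
  -- the two units
  obtain ⟨b, hbθ, hb⟩ := exists_ringOfIntegers_cubic_root (p := -1) (q := -5) (r := 3) hθ
  have hbgen : algebraMap (𝓞 K) K b = IntermediateField.AdjoinSimple.gen ℚ θ := Subtype.ext hbθ
  have hb' : b ^ 3 + (-1 : 𝓞 K) * b ^ 2 + (-5 : 𝓞 K) * b + (3 : 𝓞 K) = 0 := by
    have h := hb
    push_cast at h
    linear_combination h
  obtain ⟨e₁, he₁⟩ : ∃ e : (𝓞 K)ˣ, ((e : 𝓞 K) : K) = ((2 : ℤ) : K) + ((-4 : ℤ) : K) * IntermediateField.AdjoinSimple.gen ℚ θ +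
      ((1 : ℤ) : K) * IntermediateField.AdjoinSimple.gen ℚ θ ^ 2 :=
    ⟨_, coe_mkOfMulEqOne_quad hbgen (2) (-4) (1)
      (((26 : ℤ) : 𝓞 K) + ((2 : ℤ) : 𝓞 K) * b + ((-5 : ℤ) : 𝓞 K) * b ^ 2)
      (by push_cast; linear_combination ((17 : 𝓞 K) + (-5 : 𝓞 K) * b) * hb')⟩
  obtain ⟨e₂, he₂⟩ : ∃ e : (𝓞 K)ˣ, ((e : 𝓞 K) : K) = ((-10 : ℤ) : K) + ((-1 : ℤ) : K) * IntermediateField.AdjoinSimple.gen ℚ θ +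
      ((2 : ℤ) : K) * IntermediateField.AdjoinSimple.gen ℚ θ ^ 2 :=
    ⟨_, coe_mkOfMulEqOne_quad hbgen (-10) (-1) (2)
      (((-1 : ℤ) : 𝓞 K) + ((1 : ℤ) : 𝓞 K) * b + ((1 : ℤ) : 𝓞 K) * b ^ 2)
      (by push_cast; linear_combination ((3 : 𝓞 K) + (2 : 𝓞 K) * b) * hb')⟩
  -- sign bits at the three embeddings (endpoint tests)
  have hs₁ : ∀ j, signVec e₁ (ρ j) = ![0, 0, 1] j := by
    intro j; fin_cases j
    · show signVec e₁ ρ₀ = 0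
      refine signVec_apply_eq_zero_of_pos ρ₀ e₁ hρ₀ he₁ ?_
      have := quadratic_pos_of_endpoints (a₀ := (2 : ℝ)) (a₁ := -4) (a₂ := 1) (m := 14) hl₀.le hu₀.le (by norm_num)
        (by norm_num) (by norm_num) (by norm_num)
      push_cast; linarith
    · show signVec e₁ ρ₁ = 0
      refine signVec_apply_eq_zero_of_pos ρ₁ e₁ hρ₁ he₁ ?_
      have := quadratic_pos_of_endpoints (a₀ := (2 : ℝ)) (a₁ := -4) (a₂ := 1) (m := 1 / 50) hl₁.le hu₁.le (by norm_num)
        (by norm_num) (by norm_num) (by norm_num)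
      push_cast; linarith
    · show signVec e₁ ρ₂ = 1
      refine signVec_apply_eq_one_of_neg ρ₂ e₁ hρ₂ he₁ ?_
      have := quadratic_neg_of_endpoints (a₀ := (2 : ℝ)) (a₁ := -4) (a₂ := 1) (m := 1) hl₂.le hu₂.le (by norm_num)
        (by norm_num) (by norm_num) (by norm_num)
      push_cast; linarith
  have hs₂ : ∀ j, signVec e₂ (ρ j) = ![0, 1, 0] j := by
    intro j; fin_cases j
    · show signVec e₂ ρ₀ = 0
      refine signVec_apply_eq_zero_of_pos ρ₀ e₂ hρ₀ he₂ ?_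
      have := quadratic_pos_of_endpoints (a₀ := (-10 : ℝ)) (a₁ := -1) (a₂ := 2) (m := 1 / 2) hl₀.le hu₀.le (by norm_num)
        (by norm_num) (by norm_num) (by norm_num)
      push_cast; linarith
    · show signVec e₂ ρ₁ = 1
      refine signVec_apply_eq_one_of_neg ρ₁ e₂ hρ₁ he₂ ?_
      have := quadratic_neg_of_endpoints (a₀ := (-10 : ℝ)) (a₁ := -1) (a₂ := 2) (m := 9) hl₁.le hu₁.le (by norm_num)
        (by norm_num) (by norm_num) (by norm_num)
      push_cast; linarith
    · show signVec e₂ ρ₂ = 0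
      refine signVec_apply_eq_zero_of_pos ρ₂ e₂ hρ₂ he₂ ?_
      have := quadratic_pos_of_endpoints (a₀ := (-10 : ℝ)) (a₁ := -1) (a₂ := 2) (m := 1 / 10) hl₂.le hu₂.le (by norm_num)
        (by norm_num) (by norm_num) (by norm_num)
      push_cast; linarith
  exact signVec_surjective_of_two_units h3 ρ hρ e₁ e₂ ![0, 0, 1] ![0, 1, 0] hs₁ hs₂ (by decide)


/-! ### The totally real cubic field `d = 756`: `X³ − 6X − 2` (rows `189c1, 189d1`) -/

/-- **The units of the totally real cubic field `ℚ(θ)`, `θ` a root of `X³ − 6X − 2` (`d = 756`), take ALL EIGHT signatures** — KERNEL: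
three real roots isolated in rational intervals of width `10⁻⁵`; units `u₁ = -1 − 5θ − 2θ²`, `u₂ = -5 + 1θ²` (`-imc` D-imc-85
witnesses, inverses `1 − 3θ + 1θ²`, `-1 − 2θ + 1θ²`) with sign bits `(0, 0, 1)`, `(0, 1, 0)` at the three embeddings;
`signVec_surjective_of_two_units`. [cite: FrohlichTaylor1990, Ch. V §1 (1.12), p. 164] [cite: Cohen1993, §4.1.3 and App. B (d = 756)] -/
theorem signVec_surjective_cubicField_d756p {θ : AlgebraicClosure ℚ}
    (hθ : aeval θ (Cubic.toPoly ⟨1, ((0 : ℤ) : ℚ), ((-6 : ℤ) : ℚ), ((-2 : ℤ) : ℚ)⟩) = 0)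
    [NumberField (IntermediateField.adjoin ℚ {θ})] :
    Function.Surjective (signVec (K := ↥(IntermediateField.adjoin ℚ {θ}))) := by
  set K := IntermediateField.adjoin ℚ {θ} with hKdef
  have h3 : Module.finrank ℚ K = 3 := finrank_adjoin_eq_three_of_irreducible irreducible_cubic_twoDivField_d756p hθ
  -- three real roots
  obtain ⟨x₀, hl₀, hu₀, hx₀⟩ := exists_cubic_root_Ioo_of_neg_of_pos (p := (0 : ℝ)) (q := -6) (r := -2)
    (l := -226181 / 100000) (u := -11309 / 5000) (by norm_num) (by norm_num) (by norm_num)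
  obtain ⟨x₁, hl₁, hu₁, hx₁⟩ := exists_cubic_root_Ioo_of_pos_of_neg (p := (0 : ℝ)) (q := -6) (r := -2)
    (l := -8497 / 25000) (u := -33987 / 100000) (by norm_num) (by norm_num) (by norm_num)
  obtain ⟨x₂, hl₂, hu₂, hx₂⟩ := exists_cubic_root_Ioo_of_neg_of_pos (p := (0 : ℝ)) (q := -6) (r := -2)
    (l := 260167 / 100000) (u := 32521 / 12500) (by norm_num) (by norm_num) (by norm_num)
  have haev : ∀ x : ℝ, x ^ 3 + (0) * x ^ 2 + (-6) * x + (-2) = 0 →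
      aeval x (Cubic.toPoly ⟨1, ((0 : ℤ) : ℚ), ((-6 : ℤ) : ℚ), ((-2 : ℤ) : ℚ)⟩) = 0 := fun x hx => by
    simp only [Cubic.toPoly, map_one, one_mul, aeval_add, aeval_mul, aeval_C, aeval_X_pow, aeval_X, eq_ratCast,
      Rat.cast_intCast]
    push_cast
    linear_combination hx
  obtain ⟨ρ₀, hρ₀⟩ := exists_ringHom_adjoin_apply_gen_eq (P := ⟨1, ((0 : ℤ) : ℚ), ((-6 : ℤ) : ℚ), ((-2 : ℤ) : ℚ)⟩) rfl
    irreducible_cubic_twoDivField_d756p hθ (haev x₀ hx₀)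
  obtain ⟨ρ₁, hρ₁⟩ := exists_ringHom_adjoin_apply_gen_eq (P := ⟨1, ((0 : ℤ) : ℚ), ((-6 : ℤ) : ℚ), ((-2 : ℤ) : ℚ)⟩) rfl
    irreducible_cubic_twoDivField_d756p hθ (haev x₁ hx₁)
  obtain ⟨ρ₂, hρ₂⟩ := exists_ringHom_adjoin_apply_gen_eq (P := ⟨1, ((0 : ℤ) : ℚ), ((-6 : ℤ) : ℚ), ((-2 : ℤ) : ℚ)⟩) rfl
    irreducible_cubic_twoDivField_d756p hθ (haev x₂ hx₂)
  have hx01 : x₀ ≠ x₁ := by intro h; rw [h] at hu₀; linarith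
  have hx02 : x₀ ≠ x₂ := by intro h; rw [h] at hu₀; linarith
  have hx12 : x₁ ≠ x₂ := by intro h; rw [h] at hu₁; linarith
  set ρ : Fin 3 → (K →+* ℝ) := ![ρ₀, ρ₁, ρ₂] with hρdef
  have hne : ∀ {φ ψ : K →+* ℝ} {a c : ℝ}, φ (IntermediateField.AdjoinSimple.gen ℚ θ) = a →
      ψ (IntermediateField.AdjoinSimple.gen ℚ θ) = c → a ≠ c → φ ≠ ψ := by
    intro φ ψ a c ha hc hac h
    rw [h] at ha
    exact hac (ha.symm.trans hc)
  have hρ : Function.Injective ρ :=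
    injective_fin_three' (hne hρ₀ hρ₁ hx01) (hne hρ₀ hρ₂ hx02) (hne hρ₁ hρ₂ hx12)
  -- the two units
  obtain ⟨b, hbθ, hb⟩ := exists_ringOfIntegers_cubic_root (p := 0) (q := -6) (r := -2) hθ
  have hbgen : algebraMap (𝓞 K) K b = IntermediateField.AdjoinSimple.gen ℚ θ := Subtype.ext hbθ
  have hb' : b ^ 3 + (0 : 𝓞 K) * b ^ 2 + (-6 : 𝓞 K) * b + (-2 : 𝓞 K) = 0 := by
    have h := hb
    push_cast at h
    linear_combination h
  obtain ⟨e₁, he₁⟩ : ∃ e : (𝓞 K)ˣ, ((e : 𝓞 K) : K) = ((-1 : ℤ) : K) + ((-5 : ℤ) : K) * IntermediateField.AdjoinSimple.gen ℚ θ +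
      ((-2 : ℤ) : K) * IntermediateField.AdjoinSimple.gen ℚ θ ^ 2 :=
    ⟨_, coe_mkOfMulEqOne_quad hbgen (-1) (-5) (-2)
      (((1 : ℤ) : 𝓞 K) + ((-3 : ℤ) : 𝓞 K) * b + ((1 : ℤ) : 𝓞 K) * b ^ 2)
      (by push_cast; linear_combination ((1 : 𝓞 K) + (-2 : 𝓞 K) * b) * hb')⟩
  obtain ⟨e₂, he₂⟩ : ∃ e : (𝓞 K)ˣ, ((e : 𝓞 K) : K) = ((-5 : ℤ) : K) + ((0 : ℤ) : K) * IntermediateField.AdjoinSimple.gen ℚ θ +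
      ((1 : ℤ) : K) * IntermediateField.AdjoinSimple.gen ℚ θ ^ 2 :=
    ⟨_, coe_mkOfMulEqOne_quad hbgen (-5) (0) (1)
      (((-1 : ℤ) : 𝓞 K) + ((-2 : ℤ) : 𝓞 K) * b + ((1 : ℤ) : 𝓞 K) * b ^ 2)
      (by push_cast; linear_combination ((-2 : 𝓞 K) + (1 : 𝓞 K) * b) * hb')⟩
  -- sign bits at the three embeddings (endpoint tests)
  have hs₁ : ∀ j, signVec e₁ (ρ j) = ![0, 0, 1] j := by
    intro j; fin_cases j
    · show signVec e₁ ρ₀ = 0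
      refine signVec_apply_eq_zero_of_pos ρ₀ e₁ hρ₀ he₁ ?_
      have := quadratic_pos_of_endpoints (a₀ := (-1 : ℝ)) (a₁ := -5) (a₂ := -2) (m := 1 / 20) hl₀.le hu₀.le (by norm_num)
        (by norm_num) (by norm_num) (by norm_num)
      push_cast; linarith
    · show signVec e₁ ρ₁ = 0
      refine signVec_apply_eq_zero_of_pos ρ₁ e₁ hρ₁ he₁ ?_
      have := quadratic_pos_of_endpoints (a₀ := (-1 : ℝ)) (a₁ := -5) (a₂ := -2) (m := 1 / 4) hl₁.le hu₁.le (by norm_num)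
        (by norm_num) (by norm_num) (by norm_num)
      push_cast; linarith
    · show signVec e₁ ρ₂ = 1
      refine signVec_apply_eq_one_of_neg ρ₂ e₁ hρ₂ he₁ ?_
      have := quadratic_neg_of_endpoints (a₀ := (-1 : ℝ)) (a₁ := -5) (a₂ := -2) (m := 27) hl₂.le hu₂.le (by norm_num)
        (by norm_num) (by norm_num) (by norm_num)
      push_cast; linarith
  have hs₂ : ∀ j, signVec e₂ (ρ j) = ![0, 1, 0] j := by
    intro j; fin_cases j
    · show signVec e₂ ρ₀ = 0
      refine signVec_apply_eq_zero_of_pos ρ₀ e₂ hρ₀ he₂ ?_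
      have := quadratic_pos_of_endpoints (a₀ := (-5 : ℝ)) (a₁ := 0) (a₂ := 1) (m := 1 / 10) hl₀.le hu₀.le (by norm_num)
        (by norm_num) (by norm_num) (by norm_num)
      push_cast; linarith
    · show signVec e₂ ρ₁ = 1
      refine signVec_apply_eq_one_of_neg ρ₁ e₂ hρ₁ he₂ ?_
      have := quadratic_neg_of_endpoints (a₀ := (-5 : ℝ)) (a₁ := 0) (a₂ := 1) (m := 4) hl₁.le hu₁.le (by norm_num)
        (by norm_num) (by norm_num) (by norm_num)
      push_cast; linarith
    · show signVec e₂ ρ₂ = 0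
      refine signVec_apply_eq_zero_of_pos ρ₂ e₂ hρ₂ he₂ ?_
      have := quadratic_pos_of_endpoints (a₀ := (-5 : ℝ)) (a₁ := 0) (a₂ := 1) (m := 1) hl₂.le hu₂.le (by norm_num)
        (by norm_num) (by norm_num) (by norm_num)
      push_cast; linarith
  exact signVec_surjective_of_two_units h3 ρ hρ e₁ e₂ ![0, 0, 1] ![0, 1, 0] hs₁ hs₂ (by decide)

end Certificates

end Summit.BirchSwinnertonDyer.BirchSwinnertonDyer.Theorems.AddKatoTwo

end
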